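import Literature.AlgebraicGeometry.Modules.TensorStalkPresheaf
import HarnessLib

/-!
# Stalks of the tensor product of `𝒪_X`-modules, II: `(N ⊗ M)_x ≅ N_x ⊗_{𝒪_{X,x}} M_x` (Stacks 01CA, Lemma 17.16.1)

Continuation of `Modules/TensorStalkPresheaf` (the stalk `TStalk N M x` of the presheaf tensor product and the linear map
`toTensor : TStalk N M x → N_x ⊗ M_x`). The Stacks Project, Tag 01CA (Modules, Lemma 17.16.1): "There is a canonical isomorphism of
`𝒪_{X,x}`-modules `(𝓕 ⊗_{𝒪_X} 𝓖)_x = 𝓕_x ⊗_{𝒪_{X,x}} 𝓖_x` functorial in `𝓕` and `𝓖`." This file PROVES it for the tree's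
`Modules.tensorObj` and `Modules.stalkFunctor` (0 named facts, no instances):

* §1 the inverse `ofTensor : N_x ⊗ M_x →ₗ TStalk N M x`, `germ_U n ⊗ germ_V m ↦ germ_{U ∩ V}(n| ⊗ m|)` (`TensorProduct.lift` of a bilinear
  map built by two `colimit.desc`), and **`tstalkEquiv : TStalk N M x ≃ₗ[𝒪_{X,x}] N_x ⊗ M_x`** ("tensor products commute with filtered
  colimits", written out);
* §2 **`unitStalkEquiv : TStalk N M x ≃ₗ[𝒪_{X,x}] (N ⊗ M)_x`** — sheafification does not change stalks: surjective by Mathlib's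
  `locally_surjective_iff_surjective_on_stalks`, injective by the tree's `exists_resP_eq_zero_nhds`;
* §3 **`stalkTensorEquiv N M x : (N ⊗ M)_x ≃ₗ[𝒪_{X,x}] N_x ⊗_{𝒪_{X,x}} M_x`** with `germ_U(n ⊗ m) ↦ germ_U n ⊗ germ_U m`
  (`stalkTensorEquiv_germ_tmulSection`, `stalkTensorEquiv_symm_tmul`), the induction principle `stalk_tensorObj_induction`, and
  NATURALITY in both variables (`stalkTensorEquiv_naturality_right/left`): `(𝟙 ⊗ φ)_x ↔ 𝟙 ⊗ φ_x`, `(ψ ⊗ 𝟙)_x ↔ ψ_x ⊗ 𝟙`.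

Use (cell `pub-hodge-ring2`, crux 26512, the 0-fact lane [BOX-RES] «the external product of strictly perfect resolutions resolves the
external product»: exactness of `N ↦ p^*G ⊗ q^*N` on a product over a field is checked on stalks through this isomorphism and
`Modules/PullbackStalk.stalkPullbackIso`); library only.

## References

* The Stacks Project, Tag 01CA (Modules, Lemma 17.16.1: stalks of the tensor product), Tag 007X (stalks and sheafification). [StacksProject]
* U. Görtz, T. Wedhorn, *Algebraic Geometry I* (2nd ed. 2020), (7.4.7), Prop. 7.17 (`(𝓕 ⊗ 𝓖)_x = 𝓕_x ⊗ 𝓖_x`). [GortzWedhorn2020]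
-/

noncomputable section

-- `TopCat.Presheaf`/`Scheme.Modules` are not reducible (as in Mathlib's `AlgebraicGeometry/Modules/Sheaf.lean`).
set_option backward.isDefEq.respectTransparency false

open CategoryTheory CategoryTheory.Limits AlgebraicGeometry Opposite TopologicalSpace MonoidalCategory
open scoped TensorProduct

universe u

namespace Literature.AlgebraicGeometry.Modules

variable {X : Scheme.{u}} (N M : X.Modules) (x : X)

/-! ### §1 The inverse `N_x ⊗ M_x → TStalk N M x` and `tstalkEquiv` -/

section PresheafStalk

/-- For a section `n ∈ N(U)`: the cocone `M(V) → TStalk`, `m ↦ germ_{U ∩ V}(n| ⊗ m|)`. [cite: StacksProject, Tag 01CA (Lemma 17.16.1)] -/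
def ofTensorCocone₁ (U : X.Opens) (hxU : x ∈ U) (n : secMod N U) : Cocone ((OpenNhds.inclusion x).op ⋙ M.presheaf) where
  pt := AddCommGrpCat.of (TStalk N M x)
  ι :=
    { app := fun V => AddCommGrpCat.ofHom
        { toFun := fun m => tgermPair N M x U hxU n V.unop.1 V.unop.2 m
          map_zero' := tgermPair_zero_right N M x U hxU n _ _
          map_add' := fun m m' => tgermPair_add_right N M x U hxU n _ _ m m' }
      naturality := fun V W i => by
        ext m
        exact tgermPair_res_right N M x U hxU n (i.unop.le : W.unop.1 ≤ V.unop.1) W.unop.2 m }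

/-- For `n ∈ N(U)`: `M_x → TStalk`, `germ_V m ↦ germ_{U ∩ V}(n| ⊗ m|)`, as an additive map. [cite: StacksProject, Tag 01CA] -/
def ofTensorFun₁ (U : X.Opens) (hxU : x ∈ U) (n : secMod N U) : MStalk x M →+ TStalk N M x :=
  (colimit.desc ((OpenNhds.inclusion x).op ⋙ M.presheaf) (ofTensorCocone₁ N M x U hxU n)).hom

/-- Value on a germ. [cite: StacksProject, Tag 01CA] -/
theorem ofTensorFun₁_germ (U : X.Opens) (hxU : x ∈ U) (n : secMod N U) (V : X.Opens) (hxV : x ∈ V) (m : secMod M V) :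
    ofTensorFun₁ N M x U hxU n (stalkGerm x M V hxV m) = tgermPair N M x U hxU n V hxV m := by
  change (colimit.desc _ (ofTensorCocone₁ N M x U hxU n)) (colimit.ι ((OpenNhds.inclusion x).op ⋙ M.presheaf) (op ⟨V, hxV⟩) m) = _
  rw [colimit.ι_desc_apply]
  rfl

/-- `ofTensorFun₁ n` is `𝒪_{X,x}`-linear. [cite: StacksProject, Tag 01CA] -/
theorem ofTensorFun₁_smul (U : X.Opens) (hxU : x ∈ U) (n : secMod N U) (r : X.presheaf.stalk x) (w : MStalk x M) :
    ofTensorFun₁ N M x U hxU n (r • w) = r • ofTensorFun₁ N M x U hxU n w := by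
  obtain ⟨U', hxU', r, rfl⟩ := X.presheaf.exists_germ_eq r
  obtain ⟨V, hxV, m, rfl⟩ := exists_stalkGerm_eq x M w
  have hxW : x ∈ U' ⊓ V := ⟨hxU', hxV⟩
  -- move `r` and `m` to `U' ⊓ V`
  rw [← X.presheaf.germ_res_apply (homOfLE inf_le_left : U' ⊓ V ⟶ U') x hxW, ← stalkGerm_res x M (inf_le_right : U' ⊓ V ≤ V) hxW]
  generalize X.presheaf.map (homOfLE inf_le_left : U' ⊓ V ⟶ U').op r = r'
  generalize res M (inf_le_right : U' ⊓ V ≤ V) m = m'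
  have h : X.presheaf.germ (U' ⊓ V) x hxW r' • stalkGerm x M (U' ⊓ V) hxW m' = stalkGerm x M (U' ⊓ V) hxW (r' • m') :=
    (germ_smul x M (U' ⊓ V) hxW r' m').symm
  rw [h, ofTensorFun₁_germ, ofTensorFun₁_germ, tgermPair_smul_right]

/-- For `n ∈ N(U)`: the `𝒪_{X,x}`-linear map `M_x → TStalk`, `germ_V m ↦ germ_{U ∩ V}(n| ⊗ m|)`. [cite: StacksProject, Tag 01CA] -/
def ofTensor₁ (U : X.Opens) (hxU : x ∈ U) (n : secMod N U) : MStalk x M →ₗ[X.presheaf.stalk x] TStalk N M x where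
  toFun := ofTensorFun₁ N M x U hxU n
  map_add' := map_add _
  map_smul' := ofTensorFun₁_smul N M x U hxU n

/-- Value of `ofTensor₁` on a germ. [cite: StacksProject, Tag 01CA] -/
theorem ofTensor₁_germ (U : X.Opens) (hxU : x ∈ U) (n : secMod N U) (V : X.Opens) (hxV : x ∈ V) (m : secMod M V) :
    ofTensor₁ N M x U hxU n (stalkGerm x M V hxV m) = tgermPair N M x U hxU n V hxV m :=
  ofTensorFun₁_germ N M x U hxU n V hxV m

/-- `ofTensor₁` is additive in `n`. [cite: StacksProject, Tag 01CA] -/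
theorem ofTensor₁_add (U : X.Opens) (hxU : x ∈ U) (n n' : secMod N U) :
    ofTensor₁ N M x U hxU (n + n') = ofTensor₁ N M x U hxU n + ofTensor₁ N M x U hxU n' := by
  ext w
  obtain ⟨V, hxV, m, rfl⟩ := exists_stalkGerm_eq x M w
  rw [LinearMap.add_apply, ofTensor₁_germ, ofTensor₁_germ, ofTensor₁_germ, tgermPair_add_left]

/-- `ofTensor₁` at `0` is `0`. [cite: StacksProject, Tag 01CA] -/
theorem ofTensor₁_zero (U : X.Opens) (hxU : x ∈ U) : ofTensor₁ N M x U hxU 0 = 0 := by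
  ext w
  obtain ⟨V, hxV, m, rfl⟩ := exists_stalkGerm_eq x M w
  rw [LinearMap.zero_apply, ofTensor₁_germ, tgermPair_zero_left]

/-- `ofTensor₁` is compatible with restricting `n`. [cite: StacksProject, Tag 01CA] -/
theorem ofTensor₁_res {U U' : X.Opens} (hU' : U' ≤ U) (hxU' : x ∈ U') (n : secMod N U) :
    ofTensor₁ N M x U' hxU' (res N hU' n) = ofTensor₁ N M x U (hU' hxU') n := by
  ext w
  obtain ⟨V, hxV, m, rfl⟩ := exists_stalkGerm_eq x M w
  rw [ofTensor₁_germ, ofTensor₁_germ, tgermPair_res_left]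

/-- `ofTensor₁ (r • n) = germ r • ofTensor₁ n`. [cite: StacksProject, Tag 01CA] -/
theorem ofTensor₁_smul_left (U : X.Opens) (hxU : x ∈ U) (r : secRing X U) (n : secMod N U) :
    ofTensor₁ N M x U hxU (r • n) = X.presheaf.germ U x hxU r • ofTensor₁ N M x U hxU n := by
  ext w
  obtain ⟨V, hxV, m, rfl⟩ := exists_stalkGerm_eq x M w
  rw [LinearMap.smul_apply, ofTensor₁_germ, ofTensor₁_germ, tgermPair_smul_left]

/-- The cocone `N(U) → Hom_{𝒪_{X,x}}(M_x, TStalk)`, `n ↦ ofTensor₁ n`. [cite: StacksProject, Tag 01CA (Lemma 17.16.1)] -/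
def ofTensorCocone₂ : Cocone ((OpenNhds.inclusion x).op ⋙ N.presheaf) where
  pt := AddCommGrpCat.of (MStalk x M →ₗ[X.presheaf.stalk x] TStalk N M x)
  ι :=
    { app := fun U => AddCommGrpCat.ofHom
        { toFun := fun n => ofTensor₁ N M x U.unop.1 U.unop.2 n
          map_zero' := ofTensor₁_zero N M x _ _
          map_add' := ofTensor₁_add N M x _ _ }
      naturality := fun U V i => by
        ext n
        exact ofTensor₁_res N M x (i.unop.le : V.unop.1 ≤ U.unop.1) V.unop.2 n }

/-- `N_x → Hom(M_x, TStalk)`, `germ_U n ↦ ofTensor₁ n`, as an additive map. [cite: StacksProject, Tag 01CA (Lemma 17.16.1)] -/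
def ofTensorFun₂ : MStalk x N →+ (MStalk x M →ₗ[X.presheaf.stalk x] TStalk N M x) :=
  (colimit.desc ((OpenNhds.inclusion x).op ⋙ N.presheaf) (ofTensorCocone₂ N M x)).hom

/-- Value on a germ. [cite: StacksProject, Tag 01CA] -/
theorem ofTensorFun₂_germ (U : X.Opens) (hxU : x ∈ U) (n : secMod N U) :
    ofTensorFun₂ N M x (stalkGerm x N U hxU n) = ofTensor₁ N M x U hxU n := by
  change (colimit.desc _ (ofTensorCocone₂ N M x)) (colimit.ι ((OpenNhds.inclusion x).op ⋙ N.presheaf) (op ⟨U, hxU⟩) n) = _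
  rw [colimit.ι_desc_apply]
  rfl

/-- `ofTensorFun₂` is `𝒪_{X,x}`-linear. [cite: StacksProject, Tag 01CA] -/
theorem ofTensorFun₂_smul (r : X.presheaf.stalk x) (v : MStalk x N) :
    ofTensorFun₂ N M x (r • v) = r • ofTensorFun₂ N M x v := by
  obtain ⟨U', hxU', r, rfl⟩ := X.presheaf.exists_germ_eq r
  obtain ⟨U, hxU, n, rfl⟩ := exists_stalkGerm_eq x N v
  have hxW : x ∈ U' ⊓ U := ⟨hxU', hxU⟩
  rw [← X.presheaf.germ_res_apply (homOfLE inf_le_left : U' ⊓ U ⟶ U') x hxW, ← stalkGerm_res x N (inf_le_right : U' ⊓ U ≤ U) hxW]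
  generalize X.presheaf.map (homOfLE inf_le_left : U' ⊓ U ⟶ U').op r = r'
  generalize res N (inf_le_right : U' ⊓ U ≤ U) n = n'
  have h : X.presheaf.germ (U' ⊓ U) x hxW r' • stalkGerm x N (U' ⊓ U) hxW n' = stalkGerm x N (U' ⊓ U) hxW (r' • n') :=
    (germ_smul x N (U' ⊓ U) hxW r' n').symm
  rw [h, ofTensorFun₂_germ, ofTensorFun₂_germ, ofTensor₁_smul_left]

/-- The `𝒪_{X,x}`-bilinear map `N_x → M_x → TStalk`, `(germ_U n, germ_V m) ↦ germ_{U ∩ V}(n| ⊗ m|)`.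
[cite: StacksProject, Tag 01CA (Lemma 17.16.1)] -/
def ofTensorBilin : MStalk x N →ₗ[X.presheaf.stalk x] MStalk x M →ₗ[X.presheaf.stalk x] TStalk N M x where
  toFun := ofTensorFun₂ N M x
  map_add' := map_add _
  map_smul' := ofTensorFun₂_smul N M x

/-- **`N_x ⊗ M_x →ₗ[𝒪_{X,x}] TStalk N M x`, `germ_U n ⊗ germ_V m ↦ germ_{U ∩ V}(n| ⊗ m|)`.** [cite: StacksProject, Tag 01CA (Lemma 17.16.1)] -/
def ofTensor : MStalk x N ⊗[X.presheaf.stalk x] MStalk x M →ₗ[X.presheaf.stalk x] TStalk N M x :=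
  TensorProduct.lift (ofTensorBilin N M x)

/-- Value on a pure tensor of germs. [cite: StacksProject, Tag 01CA] -/
theorem ofTensor_tmul (U : X.Opens) (hxU : x ∈ U) (n : secMod N U) (V : X.Opens) (hxV : x ∈ V) (m : secMod M V) :
    ofTensor N M x (stalkGerm x N U hxU n ⊗ₜ[X.presheaf.stalk x] stalkGerm x M V hxV m) = tgermPair N M x U hxU n V hxV m := by
  rw [ofTensor, TensorProduct.lift.tmul]
  change ofTensorFun₂ N M x (stalkGerm x N U hxU n) (stalkGerm x M V hxV m) = _
  rw [ofTensorFun₂_germ, ofTensor₁_germ]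

/-- `ofTensor ∘ toTensor = id`. [cite: StacksProject, Tag 01CA (Lemma 17.16.1)] -/
theorem ofTensor_toTensor (t : TStalk N M x) : ofTensor N M x (toTensor N M x t) = t := by
  induction t using tstalk_induction N M x with
  | tmul U hx n m =>
    change ofTensor N M x (toTensorFun N M x (tgerm N M x U hx (n ⊗ₜ m))) = _
    rw [toTensorFun_tgerm_tmul, ofTensor_tmul, tgermPair_self]
  | zero => rw [map_zero, map_zero]
  | add a b ha hb => rw [map_add, map_add, ha, hb]

/-- `toTensor ∘ ofTensor = id`. [cite: StacksProject, Tag 01CA (Lemma 17.16.1)] -/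
theorem toTensor_ofTensor (v : MStalk x N ⊗[X.presheaf.stalk x] MStalk x M) : toTensor N M x (ofTensor N M x v) = v := by
  induction v using TensorProduct.induction_on with
  | zero => rw [map_zero, map_zero]
  | tmul a b =>
    obtain ⟨U, hxU, n, rfl⟩ := exists_stalkGerm_eq x N a
    obtain ⟨V, hxV, m, rfl⟩ := exists_stalkGerm_eq x M b
    have hxW : x ∈ U ⊓ V := ⟨hxU, hxV⟩
    -- move both germs to `U ⊓ V`
    rw [← stalkGerm_res x N (inf_le_left : U ⊓ V ≤ U) hxW, ← stalkGerm_res x M (inf_le_right : U ⊓ V ≤ V) hxW, ofTensor_tmul,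
      tgermPair_self]
    exact toTensorFun_tgerm_tmul N M x _ _ _ _
  | add a b ha hb => rw [map_add, map_add, ha, hb]

/-- **`TStalk N M x ≃ₗ[𝒪_{X,x}] N_x ⊗_{𝒪_{X,x}} M_x`** — the stalk of the presheaf tensor product is the tensor product of the
stalks ("tensor products commute with filtered colimits"). [cite: StacksProject, Tag 01CA (Lemma 17.16.1)] -/
def tstalkEquiv : TStalk N M x ≃ₗ[X.presheaf.stalk x] MStalk x N ⊗[X.presheaf.stalk x] MStalk x M :=
  LinearEquiv.ofLinear (toTensor N M x) (ofTensor N M x) (LinearMap.ext (toTensor_ofTensor N M x))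
    (LinearMap.ext (ofTensor_toTensor N M x))

/-- `tstalkEquiv (germ_U(n ⊗ m)) = germ_U n ⊗ germ_U m`. [cite: StacksProject, Tag 01CA (Lemma 17.16.1)] -/
theorem tstalkEquiv_tgerm_tmul (U : X.Opens) (hx : x ∈ U) (n : secMod N U) (m : secMod M U) :
    tstalkEquiv N M x (tgerm N M x U hx (n ⊗ₜ m)) = stalkGerm x N U hx n ⊗ₜ[X.presheaf.stalk x] stalkGerm x M U hx m :=
  toTensorFun_tgerm_tmul N M x U hx n m

/-- `tstalkEquiv.symm (germ_U n ⊗ germ_U m) = germ_U(n ⊗ m)`. [cite: StacksProject, Tag 01CA (Lemma 17.16.1)] -/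
theorem tstalkEquiv_symm_tmul (U : X.Opens) (hx : x ∈ U) (n : secMod N U) (m : secMod M U) :
    (tstalkEquiv N M x).symm (stalkGerm x N U hx n ⊗ₜ[X.presheaf.stalk x] stalkGerm x M U hx m) = tgerm N M x U hx (n ⊗ₜ m) := by
  change ofTensor N M x _ = _
  rw [ofTensor_tmul, tgermPair_self]

end PresheafStalk

/-! ### §2 Sheafification does not change stalks: `TStalk N M x ≃ (N ⊗ M)_x` -/

section UnitStalk

/-- The sheafification unit of the presheaf tensor product on underlying abelian presheaves (Mathlib's `toSheafify`, `rfl`).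
[cite: StacksProject, Tag 007X] -/
def tensorUnitAb : tensorPresheafAb N M ⟶ (tensorObj N M).presheaf :=
  (PresheafOfModules.toPresheaf _).map (tensorUnitHom N M)

/-- On underlying abelian presheaves the unit is Mathlib's `toSheafify`. [cite: GortzWedhorn2020, (7.1) and (7.4.7)] -/
theorem tensorUnitAb_eq : tensorUnitAb N M = toSheafify (Opens.grothendieckTopology X) (tensorPresheaf N M).presheaf := rfl

/-- The unit on sections is `tensorUnitHom` on sections. [cite: GortzWedhorn2020, (7.1) and (7.4.7)] -/
theorem tensorUnitAb_app_apply (U : X.Opens) (q : TSec N M U) :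
    (tensorUnitAb N M).app (op U) q = (tensorUnitHom N M).app (op U) q := rfl

/-- The stalk map of the unit, `TStalk N M x → (N ⊗ M)_x`, as an additive map. [cite: StacksProject, Tag 007X] -/
def unitStalkFun : TStalk N M x →+ MStalk x (tensorObj N M) :=
  ((TopCat.Presheaf.stalkFunctor Ab x).map (tensorUnitAb N M)).hom

/-- On germs: `η_x(germ_U q) = germ_U(η_U q)`. [cite: StacksProject, Tag 007X] -/
theorem unitStalkFun_tgerm (U : X.Opens) (hx : x ∈ U) (q : TSec N M U) :
    unitStalkFun N M x (tgerm N M x U hx q) = stalkGerm x (tensorObj N M) U hx ((tensorUnitHom N M).app (op U) q) :=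
  TopCat.Presheaf.stalkFunctor_map_germ_apply U x hx (tensorUnitAb N M) q

/-- On germs of pure tensors: `η_x(germ_U(n ⊗ m)) = germ_U(n ⊗ m)` (the elementary tensor section `tmulSection`). [cite: StacksProject, Tag 01CA] -/
theorem unitStalkFun_tgerm_tmul (U : X.Opens) (hx : x ∈ U) (n : secMod N U) (m : secMod M U) :
    unitStalkFun N M x (tgerm N M x U hx (n ⊗ₜ m)) = stalkGerm x (tensorObj N M) U hx (tmulSection N M U n m) :=
  unitStalkFun_tgerm N M x U hx _

/-- The stalk map of the unit is surjective (the unit is locally surjective; Mathlib `locally_surjective_iff_surjective_on_stalks`).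
[cite: StacksProject, Tag 007X] -/
theorem unitStalkFun_surjective : Function.Surjective (unitStalkFun N M x) := by
  have h : TopCat.Presheaf.IsLocallySurjective (tensorUnitAb N M) := by
    rw [tensorUnitAb_eq]
    exact Presheaf.isLocallySurjective_toSheafify' _ _
  exact (TopCat.Presheaf.locally_surjective_iff_surjective_on_stalks (tensorUnitAb N M)).mp h x

/-- The stalk map of the unit is injective (the unit is locally injective: a section killed by it vanishes near `x`,
`exists_resP_eq_zero_nhds`). [cite: StacksProject, Tag 007X] -/
theorem unitStalkFun_injective : Function.Injective (unitStalkFun N M x) := by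
  refine (injective_iff_map_eq_zero _).2 fun t ht => ?_
  obtain ⟨U, hx, q, rfl⟩ := exists_tgerm_eq N M x t
  rw [unitStalkFun_tgerm] at ht
  -- the section `η_U q` of the sheaf has germ `0`, hence vanishes on some `W ∋ x`
  have ht0 : stalkGerm x (tensorObj N M) U hx ((tensorUnitHom N M).app (op U) q) = stalkGerm x (tensorObj N M) U hx 0 := by
    rw [ht, stalkGerm_zero]
  obtain ⟨W, hxW, iU, iV, hW⟩ := (tensorObj N M).presheaf.germ_eq x hx hx _ _ ht0
  rw [map_zero] at hW
  have hi : iU = homOfLE iU.le := Subsingleton.elim _ _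
  rw [hi, map_tensorUnitHom_app] at hW
  -- `η_W (q|_W) = 0`, so `q|_W` vanishes on some `W' ∋ x` (local injectivity of the unit)
  obtain ⟨W', hW', hxW', hq⟩ := exists_resP_eq_zero_nhds (tensorPresheaf N M) W (resT N M iU.le q) hW x hxW
  rw [← tgerm_resT N M x iU.le hxW, ← tgerm_resT N M x hW' hxW']
  change tgerm N M x W' hxW' (resP (tensorPresheaf N M) hW' (resT N M iU.le q)) = 0
  rw [hq, tgerm_zero]

/-- The stalk map of the unit is `𝒪_{X,x}`-linear. [cite: GortzWedhorn2020, (7.4.7)] -/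
theorem unitStalkFun_smul (r : X.presheaf.stalk x) (t : TStalk N M x) :
    unitStalkFun N M x (r • t) = r • unitStalkFun N M x t := by
  obtain ⟨U, hxU, r, rfl⟩ := X.presheaf.exists_germ_eq r
  obtain ⟨V, hxV, q, rfl⟩ := exists_tgerm_eq N M x t
  have hxW : x ∈ U ⊓ V := ⟨hxU, hxV⟩
  rw [← X.presheaf.germ_res_apply (homOfLE inf_le_left : U ⊓ V ⟶ U) x hxW, ← tgerm_resT N M x (inf_le_right : U ⊓ V ≤ V) hxW,
    ← tgerm_smul, unitStalkFun_tgerm, unitStalkFun_tgerm, tensorUnitHom_app_smul]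
  exact germ_smul x (tensorObj N M) (U ⊓ V) hxW _ _

/-- **Sheafification does not change stalks: `TStalk N M x ≃ₗ[𝒪_{X,x}] (N ⊗ M)_x`**, `germ_U q ↦ germ_U(η_U q)`.
[cite: StacksProject, Tag 007X] -/
def unitStalkEquiv : TStalk N M x ≃ₗ[X.presheaf.stalk x] MStalk x (tensorObj N M) :=
  LinearEquiv.ofBijective
    { toFun := unitStalkFun N M x
      map_add' := map_add _
      map_smul' := unitStalkFun_smul N M x }
    ⟨unitStalkFun_injective N M x, unitStalkFun_surjective N M x⟩

/-- `unitStalkEquiv (germ_U(n ⊗ m)) = germ_U(n ⊗ m)`. [cite: StacksProject, Tag 01CA] -/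
theorem unitStalkEquiv_tgerm_tmul (U : X.Opens) (hx : x ∈ U) (n : secMod N U) (m : secMod M U) :
    unitStalkEquiv N M x (tgerm N M x U hx (n ⊗ₜ m)) = stalkGerm x (tensorObj N M) U hx (tmulSection N M U n m) :=
  unitStalkFun_tgerm_tmul N M x U hx n m

/-- `unitStalkEquiv.symm (germ_U(n ⊗ m)) = germ_U(n ⊗ m)`. [cite: StacksProject, Tag 01CA] -/
theorem unitStalkEquiv_symm_germ_tmulSection (U : X.Opens) (hx : x ∈ U) (n : secMod N U) (m : secMod M U) :
    (unitStalkEquiv N M x).symm (stalkGerm x (tensorObj N M) U hx (tmulSection N M U n m)) = tgerm N M x U hx (n ⊗ₜ m) := by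
  rw [LinearEquiv.symm_apply_eq, unitStalkEquiv_tgerm_tmul]

end UnitStalk

/-! ### §3 `(N ⊗ M)_x ≃ₗ[𝒪_{X,x}] N_x ⊗ M_x`, its values, induction, and naturality in `M` -/

section Stalk

/-- **The Stacks Project, Tag 01CA (Lemma 17.16.1): `(N ⊗ M)_x ≃ₗ[𝒪_{X,x}] N_x ⊗_{𝒪_{X,x}} M_x`.** [cite: StacksProject, Tag 01CA (Lemma 17.16.1)] -/
def stalkTensorEquiv : MStalk x (tensorObj N M) ≃ₗ[X.presheaf.stalk x] MStalk x N ⊗[X.presheaf.stalk x] MStalk x M :=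
  (unitStalkEquiv N M x).symm.trans (tstalkEquiv N M x)

/-- **Value on the germ of an elementary tensor: `germ_U(n ⊗ m) ↦ germ_U n ⊗ germ_U m`.** [cite: StacksProject, Tag 01CA (Lemma 17.16.1)] -/
theorem stalkTensorEquiv_germ_tmulSection (U : X.Opens) (hx : x ∈ U) (n : secMod N U) (m : secMod M U) :
    stalkTensorEquiv N M x (stalkGerm x (tensorObj N M) U hx (tmulSection N M U n m)) =
      stalkGerm x N U hx n ⊗ₜ[X.presheaf.stalk x] stalkGerm x M U hx m := by
  rw [stalkTensorEquiv, LinearEquiv.trans_apply, unitStalkEquiv_symm_germ_tmulSection, tstalkEquiv_tgerm_tmul]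

/-- `stalkTensorEquiv.symm (germ_U n ⊗ germ_U m) = germ_U(n ⊗ m)`. [cite: StacksProject, Tag 01CA (Lemma 17.16.1)] -/
theorem stalkTensorEquiv_symm_tmul (U : X.Opens) (hx : x ∈ U) (n : secMod N U) (m : secMod M U) :
    (stalkTensorEquiv N M x).symm (stalkGerm x N U hx n ⊗ₜ[X.presheaf.stalk x] stalkGerm x M U hx m) =
      stalkGerm x (tensorObj N M) U hx (tmulSection N M U n m) := by
  rw [LinearEquiv.symm_apply_eq, stalkTensorEquiv_germ_tmulSection]

/-- **Induction on `(N ⊗ M)_x`**: a property stable under `0` and `+` holding for the germs `germ_U(n ⊗ m)` of elementary tensor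
sections holds everywhere (every element is `η_x` of a germ of a finite sum of pure tensors). [cite: StacksProject, Tag 01CA] -/
theorem stalk_tensorObj_induction {P : MStalk x (tensorObj N M) → Prop} (v : MStalk x (tensorObj N M))
    (tmul : ∀ (U : X.Opens) (hx : x ∈ U) (n : secMod N U) (m : secMod M U), P (stalkGerm x (tensorObj N M) U hx (tmulSection N M U n m)))
    (zero : P 0) (add : ∀ a b, P a → P b → P (a + b)) : P v := by
  obtain ⟨t, rfl⟩ := unitStalkFun_surjective N M x v
  induction t using tstalk_induction N M x with
  | tmul U hx n m => rw [unitStalkFun_tgerm_tmul]; exact tmul U hx n m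
  | zero => rw [map_zero]; exact zero
  | add a b ha hb => rw [map_add]; exact add _ _ ha hb

/-- **Naturality in `M`**: for `φ : M ⟶ M'` and `v ∈ (N ⊗ M)_x`, the stalk map of `𝟙_N ⊗ φ` corresponds to `𝟙 ⊗ φ_x`:
`stalkTensorEquiv ((𝟙 ⊗ φ)_x v) = (𝟙 ⊗ φ_x)(stalkTensorEquiv v)`. [cite: StacksProject, Tag 01CA (Lemma 17.16.1, functoriality)] -/
theorem stalkTensorEquiv_naturality_right {M' : X.Modules} (φ : M ⟶ M') (v : MStalk x (tensorObj N M)) :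
    stalkTensorEquiv N M' x ((stalkFunctor x).map (tensorMap (𝟙 N) φ) v) =
      TensorProduct.map LinearMap.id ((stalkFunctor x).map φ).hom (stalkTensorEquiv N M x v) := by
  induction v using stalk_tensorObj_induction N M x with
  | tmul U hx n m =>
    rw [stalkTensorEquiv_germ_tmulSection, TensorProduct.map_tmul, LinearMap.id_apply, stalkFunctor_map_germ,
      tensorMap_app_tmulSection, Scheme.Modules.Hom.id_app]
    change stalkTensorEquiv N M' x (stalkGerm x (tensorObj N M') U hx (tmulSection N M' U n (φ.app U m))) =
      stalkGerm x N U hx n ⊗ₜ[X.presheaf.stalk x] (stalkFunctor x).map φ (stalkGerm x M U hx m)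
    rw [stalkTensorEquiv_germ_tmulSection, stalkFunctor_map_germ]
  | zero => rw [map_zero, map_zero, map_zero, map_zero]
  | add a b ha hb => rw [map_add, map_add, ha, hb, map_add, map_add]

/-- **Naturality in `N`**: for `ψ : N ⟶ N'`, the stalk map of `ψ ⊗ 𝟙_M` corresponds to `ψ_x ⊗ 𝟙`.
[cite: StacksProject, Tag 01CA (Lemma 17.16.1, functoriality)] -/
theorem stalkTensorEquiv_naturality_left {N' : X.Modules} (ψ : N ⟶ N') (v : MStalk x (tensorObj N M)) :
    stalkTensorEquiv N' M x ((stalkFunctor x).map (tensorMap ψ (𝟙 M)) v) =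
      TensorProduct.map ((stalkFunctor x).map ψ).hom LinearMap.id (stalkTensorEquiv N M x v) := by
  induction v using stalk_tensorObj_induction N M x with
  | tmul U hx n m =>
    rw [stalkTensorEquiv_germ_tmulSection, TensorProduct.map_tmul, LinearMap.id_apply, stalkFunctor_map_germ,
      tensorMap_app_tmulSection, Scheme.Modules.Hom.id_app]
    change stalkTensorEquiv N' M x (stalkGerm x (tensorObj N' M) U hx (tmulSection N' M U (ψ.app U n) m)) =
      (stalkFunctor x).map ψ (stalkGerm x N U hx n) ⊗ₜ[X.presheaf.stalk x] stalkGerm x M U hx m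
    rw [stalkTensorEquiv_germ_tmulSection, stalkFunctor_map_germ]
  | zero => rw [map_zero, map_zero, map_zero, map_zero]
  | add a b ha hb => rw [map_add, map_add, ha, hb, map_add, map_add]

end Stalk

end Literature.AlgebraicGeometry.Modules

end
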